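import Summits.QuantumAdvantage.QuantumAdvantage.Theorems.SparsityDialCounterSplitGlue

/-! # EchoDialA — part 1/5 of the landing twins of NODE «EchoDial» (decomp-qadv lens-2; node file
`g22/EchoDial.lean`, sha256 2019ca7807e3a40c…; generator `g23/tree/gen_twins.py`: namespace
`Theses.EchoDial` → `Theorems.EchoDial`, cut at declaration boundaries, docstrings added where missing, nothing else).
Content: §1 ECHO CERTIFICATES — the finite calculus on flag vectors (`IsCert`, `CertFamily`, the TENSOR rule `isCert_tensor`,
the base certificate `(0,3)` by `decide`, `(1,5)` from the tree's `ResponseDial.certOK_lam`, `certFamily_all d : CertFamily d (3(d+1))`). -/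

set_option linter.dupNamespace false
noncomputable section
open scoped Classical

namespace Summit.QuantumAdvantage.QuantumAdvantage.Theorems.EchoDial
open Finset
open Literature.Computability.QuantumComplexity Literature.Computability.QuantumComplexity.RingHLF
open Literature.Computability.MetaComplexity Literature.Computability.MetaComplexity.Smolensky
open Summit.QuantumAdvantage.AdviceFreeQNC0 hiding sgn3
open Summit.QuantumAdvantage.QuantumAdvantage.Theorems.AnchorDial (outB dev cN orbF cN_orbF_cast oddZeros_orbF
  orbF_apply_of_far card_filter_orbF orbF_false win_iff gCond_iff_cN three_counts card_odd_ge loss_shape_mono)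
open Summit.QuantumAdvantage.QuantumAdvantage.Theorems.AnchorDial.Core (ct sg)
open Summit.QuantumAdvantage.QuantumAdvantage.Theorems.HolonomyDial (gCond card_odd_le)
open Summit.QuantumAdvantage.QuantumAdvantage.Theorems.StabilizerDial (pad pad_mem rel_pad_iff StabFew apStrat apStrat_mem)
open Summit.QuantumAdvantage.QuantumAdvantage.Theorems.SparsityDial (stabFew_mono_mr one_le_logpow)
open Summit.QuantumAdvantage.QuantumAdvantage.Theorems.ResponseDial (lodd lodd_mem lodd_eq_sum qpoly qpoly_mem qbit qpoly_apply
  hcStrat mem_dev_hcStrat_iff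
  sgn3 sgn3_ne dev_pad_zero not_polylogSparse_of_agree orbF_apply mod3_ne_two castZ2_of_mod_eq_zero
  castZ2_of_mod_eq_one εOf sF lam CertOK certOK_lam AddResp)
open Summit.QuantumAdvantage.QuantumAdvantage.Theses.SparsityDial (DenseGenericLoss3)
open Summit.QuantumAdvantage.QuantumAdvantage.Theorems.CounterDial (StabCounter CounterLoss3 NonCounterGenericLoss3 lin CounterForm
  xloc xloc_castLE oddZeros_xloc lin_xloc bsel mem_iff_bsel card_false_five)
open Summit.QuantumAdvantage.QuantumAdvantage.Theorems.HolonomyDial (tPoly tPoly_mem tPoly_apply xorP xorP_mem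
  xorP_apply_bool mono_singleton_apply)

/-! ## §1  ECHO CERTIFICATES — a finite calculus on flag vectors (no game, no ring)

Orbit points are flag vectors `ε : Fin F → Bool` (which of the `F` separated adjacent pairs are flipped); a position that
has passed the first `g` sites sees the `𝔽₃` kernel-phase shift `phase z ε g = Σ_i [ε_i]·(1 + [z_i ⊕ (i < g)])` for the
hidden sign vector `z` (`AnchorDial.cN_orbF_cast`).  An ECHO CERTIFICATE of degree `d` for `z` is an odd multiset `Λ` of
flag vectors such that for every monomial `S` of size `≤ d`, every group `g` and every phase `c`, the number of
`ε ∈ Λ` with `ε ⊇ S` and `c + phase z ε g ≠ 2` is even.  -/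

section Cert
variable {F F₁ F₂ : ℕ}

/-- the `𝔽₃` phase shift at orbit point `ε` seen by a position that has passed the first `g` flip sites. -/
def phase (z ε : Fin F → Bool) (g : ℕ) : ZMod 3 := ∑ i : Fin F, ct (ε i) (xor (z i) (decide (i.val < g)))

/-- the monomial `Π_{i ∈ S} ε_i` as a Boolean. -/
def monoB (S : Finset (Fin F)) (ε : Fin F → Bool) : Bool := decide (∀ i ∈ S, ε i = true)

/-- the certificate test column `(S, g, c)`: «monomial `S` is on at `ε`» ∧ «phase `c` is admissible at `ε`». -/
def tst (z : Fin F → Bool) (S : Finset (Fin F)) (g : ℕ) (c : ZMod 3) (ε : Fin F → Bool) : Bool :=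
  monoB S ε && decide (c + phase z ε g ≠ 2)

/-- **ECHO CERTIFICATE of degree `d`** for the sign vector `z`: an odd list of flag vectors meeting every test column
`(S, g, c)` with `#S ≤ d` evenly. -/
def IsCert (d : ℕ) (z : Fin F → Bool) (Λ : List (Fin F → Bool)) : Prop :=
  Λ.length % 2 = 1 ∧ ∀ S : Finset (Fin F), S.card ≤ d → ∀ (g : ℕ) (c : ZMod 3), (Λ.countP (tst z S g c)) % 2 = 0

/-- the law's finite input at `(d, F)`: every sign vector has a degree-`d` certificate on `F` sites. -/
def CertFamily (d F : ℕ) : Prop := ∀ z : Fin F → Bool, ∃ Λ : List (Fin F → Bool), IsCert d z Λ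

/-- certificates are monotone in the degree. -/
theorem isCert_mono {d d' : ℕ} (h : d' ≤ d) {z : Fin F → Bool} {Λ : List (Fin F → Bool)} (hc : IsCert d z Λ) :
    IsCert d' z Λ :=
  ⟨hc.1, fun S hS g c => hc.2 S (le_trans hS h) g c⟩

/-- certificate families are monotone in the degree: a family for degree `d` serves every `d' ≤ d`. -/
theorem certFamily_mono {d d' F : ℕ} (h : d' ≤ d) (hc : CertFamily d F) : CertFamily d' F := fun z => by
  obtain ⟨Λ, hΛ⟩ := hc z; exact ⟨Λ, isCert_mono h hΛ⟩

/-- beyond the last site the group is irrelevant. -/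
theorem phase_of_le (z ε : Fin F → Bool) {g : ℕ} (hg : F ≤ g) : phase z ε g = phase z ε F := by
  unfold phase
  refine sum_congr rfl fun i _ => ?_
  rw [decide_eq_true (by omega : i.val < g), decide_eq_true i.isLt]

/-! ### The tensor product of certificates: degrees add (plus one), sites add. -/

/-- restriction of a monomial on `F₁ + F₂` sites to the first block … -/
def lft (S : Finset (Fin (F₁ + F₂))) : Finset (Fin F₁) := univ.filter fun i => Fin.castAdd F₂ i ∈ S
/-- … and to the second block. -/
def rgt (S : Finset (Fin (F₁ + F₂))) : Finset (Fin F₂) := univ.filter fun j => Fin.natAdd F₁ j ∈ S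

/-- `#lft S + #rgt S = #S` for a set of site indices over `F₁ + F₂` sites. -/
theorem card_lft_add_rgt (S : Finset (Fin (F₁ + F₂))) : (lft S).card + (rgt S).card = S.card := by
  have h : ∑ k : Fin (F₁ + F₂), (if k ∈ S then 1 else 0) = S.card := by
    rw [← Finset.card_filter, Finset.filter_mem_eq_inter, Finset.univ_inter]
  unfold lft rgt
  rw [Finset.card_filter, Finset.card_filter, ← h, Fin.sum_univ_add]

/-- a monomial evaluated at an appended flag vector factors into its left part times its right part. -/
theorem monoB_append (S : Finset (Fin (F₁ + F₂))) (ε₁ : Fin F₁ → Bool) (ε₂ : Fin F₂ → Bool) :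
    monoB S (Fin.append ε₁ ε₂) = (monoB (lft S) ε₁ && monoB (rgt S) ε₂) := by
  unfold monoB lft rgt
  rw [← Bool.decide_and]
  refine decide_eq_decide.mpr ⟨fun h => ⟨fun i hi => ?_, fun j hj => ?_⟩, fun h k hk => ?_⟩
  · rw [mem_filter] at hi
    have := h _ hi.2
    rwa [Fin.append_left] at this
  · rw [mem_filter] at hj
    have := h _ hj.2
    rwa [Fin.append_right] at this
  · induction k using Fin.addCases with
    | left i => rw [Fin.append_left]; exact h.1 i (mem_filter.2 ⟨mem_univ _, hk⟩)
    | right j => rw [Fin.append_right]; exact h.2 j (mem_filter.2 ⟨mem_univ _, hk⟩)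

/-- the phase form splits over the two blocks; the second block's group is `g - F₁`. -/
theorem phase_append (z₁ ε₁ : Fin F₁ → Bool) (z₂ ε₂ : Fin F₂ → Bool) (g : ℕ) :
    phase (Fin.append z₁ z₂) (Fin.append ε₁ ε₂) g = phase z₁ ε₁ g + phase z₂ ε₂ (g - F₁) := by
  unfold phase
  rw [Fin.sum_univ_add]
  congr 1
  · refine sum_congr rfl fun i _ => ?_
    rw [Fin.append_left, Fin.append_left, Fin.val_castAdd]
  · refine sum_congr rfl fun j _ => ?_
    rw [Fin.append_right, Fin.append_right, Fin.val_natAdd]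
    by_cases h : F₁ + j.val < g
    · rw [decide_eq_true h, decide_eq_true (by omega : j.val < g - F₁)]
    · rw [decide_eq_false h, decide_eq_false (by omega : ¬ j.val < g - F₁)]

/-- the product list of flag vectors (block concatenation of every pair). -/
def prodList : List (Fin F₁ → Bool) → List (Fin F₂ → Bool) → List (Fin (F₁ + F₂) → Bool)
  | [], _ => []
  | a :: l, Λ₂ => (Λ₂.map fun b => Fin.append a b) ++ prodList l Λ₂

/-- the product list has `|Λ₁| · |Λ₂|` entries. -/
theorem length_prodList (Λ₁ : List (Fin F₁ → Bool)) (Λ₂ : List (Fin F₂ → Bool)) :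
    (prodList Λ₁ Λ₂).length = Λ₁.length * Λ₂.length := by
  induction Λ₁ with
  | nil => simp [prodList]
  | cons a l ih => simp [prodList, ih]; ring

/-- counting a predicate over the product list = summing, over the left list, the counts over the right list. -/
theorem countP_prodList (q : (Fin (F₁ + F₂) → Bool) → Bool) (Λ₁ : List (Fin F₁ → Bool))
    (Λ₂ : List (Fin F₂ → Bool)) :
    (prodList Λ₁ Λ₂).countP q = (Λ₁.map fun a => Λ₂.countP fun b => q (Fin.append a b)).sum := by
  induction Λ₁ with
  | nil => simp [prodList]
  | cons a l ih =>
    rw [prodList, List.countP_append, ih, List.map_cons, List.sum_cons, List.countP_map]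
    rfl

/-- a list sum of `0/1` indicators is a `countP`. -/
theorem sum_map_ite (l : List (Fin F₂ → Bool)) (q : (Fin F₂ → Bool) → Bool) :
    (l.map fun b => if q b = true then 1 else 0).sum = l.countP q := by
  induction l with
  | nil => simp
  | cons b l ih => rw [List.map_cons, List.sum_cons, ih, List.countP_cons]; omega

/-- Fubini for the product count. -/
theorem sum_countP_swap (q : (Fin F₁ → Bool) → (Fin F₂ → Bool) → Bool) (Λ₁ : List (Fin F₁ → Bool))
    (Λ₂ : List (Fin F₂ → Bool)) :
    (Λ₁.map fun a => Λ₂.countP fun b => q a b).sum = (Λ₂.map fun b => Λ₁.countP fun a => q a b).sum := by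
  induction Λ₁ with
  | nil => simp
  | cons a l ih =>
    rw [List.map_cons, List.sum_cons, ih]
    have h : (Λ₂.map fun b => (a :: l).countP fun a' => q a' b) =
        Λ₂.map fun b => (l.countP fun a' => q a' b) + (if q a b = true then 1 else 0) :=
      List.map_congr_left fun b _ => by rw [List.countP_cons]
    rw [h, List.sum_map_add, sum_map_ite, add_comm]

/-- a list sum of even numbers is even. -/
theorem sum_even {α : Type*} (l : List α) (f : α → ℕ) (h : ∀ a ∈ l, f a % 2 = 0) : (l.map f).sum % 2 = 0 := by
  induction l with
  | nil => simp
  | cons a l ih =>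
    rw [List.map_cons, List.sum_cons, Nat.add_mod, h a (by simp), ih (fun b hb => h b (by simp [hb]))]

/-- counting `u && t b` over a list is `countP t` if `u` holds and `0` otherwise. -/
theorem countP_const_and {α : Type*} (u : Bool) (t : α → Bool) (l : List α) :
    l.countP (fun b => u && t b) = if u = true then l.countP t else 0 := by
  cases u <;> simp

/-- the test column on a product point, read from the first block … -/
theorem tst_append_left (z₁ : Fin F₁ → Bool) (z₂ : Fin F₂ → Bool) (S : Finset (Fin (F₁ + F₂))) (g : ℕ)
    (c : ZMod 3) (a : Fin F₁ → Bool) (b : Fin F₂ → Bool) :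
    tst (Fin.append z₁ z₂) S g c (Fin.append a b) = (monoB (lft S) a && tst z₂ (rgt S) (g - F₁) (c + phase z₁ a g) b) := by
  unfold tst
  rw [monoB_append, phase_append, add_assoc, Bool.and_assoc]

/-- … and from the second block. -/
theorem tst_append_right (z₁ : Fin F₁ → Bool) (z₂ : Fin F₂ → Bool) (S : Finset (Fin (F₁ + F₂))) (g : ℕ)
    (c : ZMod 3) (a : Fin F₁ → Bool) (b : Fin F₂ → Bool) :
    tst (Fin.append z₁ z₂) S g c (Fin.append a b) = (monoB (rgt S) b && tst z₁ (lft S) g (c + phase z₂ b (g - F₁)) a) := by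
  unfold tst
  rw [monoB_append, phase_append, add_comm (phase z₁ a g), add_assoc]
  cases monoB (lft S) a <;> cases monoB (rgt S) b <;> simp

/-- **★ THE TENSOR LEMMA**: certificates multiply — a degree-`d₁` certificate on `F₁` sites and a degree-`d₂` certificate
on `F₂` sites give a degree-`(d₁ + d₂ + 1)` certificate on `F₁ + F₂` sites (a monomial of size `≤ d₁ + d₂ + 1` has
`≤ d₁` variables in the first block or `≤ d₂` in the second; the phase splits additively, so the count is a sum of even
fibre counts). -/
theorem isCert_tensor {d₁ d₂ : ℕ} {z₁ : Fin F₁ → Bool} {z₂ : Fin F₂ → Bool} {Λ₁ : List (Fin F₁ → Bool)}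
    {Λ₂ : List (Fin F₂ → Bool)} (h₁ : IsCert d₁ z₁ Λ₁) (h₂ : IsCert d₂ z₂ Λ₂) :
    IsCert (d₁ + d₂ + 1) (Fin.append z₁ z₂) (prodList Λ₁ Λ₂) := by
  refine ⟨?_, fun S hS g c => ?_⟩
  · rw [length_prodList, Nat.mul_mod, h₁.1, h₂.1]
  have hsplit := card_lft_add_rgt S
  rw [countP_prodList]
  by_cases hr : (rgt S).card ≤ d₂
  · refine sum_even _ _ fun a _ => ?_
    have : (fun b => tst (Fin.append z₁ z₂) S g c (Fin.append a b)) =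
        fun b => monoB (lft S) a && tst z₂ (rgt S) (g - F₁) (c + phase z₁ a g) b :=
      funext fun b => tst_append_left z₁ z₂ S g c a b
    rw [this, countP_const_and]
    split_ifs
    · exact h₂.2 _ hr _ _
    · rfl
  · have hl : (lft S).card ≤ d₁ := by omega
    rw [sum_countP_swap (fun a b => tst (Fin.append z₁ z₂) S g c (Fin.append a b))]
    refine sum_even _ _ fun b _ => ?_
    have : (fun a => tst (Fin.append z₁ z₂) S g c (Fin.append a b)) =
        fun a => monoB (rgt S) b && tst z₁ (lft S) g (c + phase z₂ b (g - F₁)) a :=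
      funext fun a => tst_append_right z₁ z₂ S g c a b
    rw [this, countP_const_and]
    split_ifs
    · exact h₁.2 _ hl _ _
    · rfl

/-- hence certificate families multiply. -/
theorem certFamily_tensor {d₁ d₂ : ℕ} (h₁ : CertFamily d₁ F₁) (h₂ : CertFamily d₂ F₂) :
    CertFamily (d₁ + d₂ + 1) (F₁ + F₂) := by
  intro z
  obtain ⟨Λ₁, hΛ₁⟩ := h₁ (fun i => z (Fin.castAdd F₂ i))
  obtain ⟨Λ₂, hΛ₂⟩ := h₂ (fun j => z (Fin.natAdd F₁ j))
  refine ⟨prodList Λ₁ Λ₂, ?_⟩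
  have hz : Fin.append (fun i => z (Fin.castAdd F₂ i)) (fun j => z (Fin.natAdd F₁ j)) = z :=
    Fin.append_castAdd_natAdd
  have h := isCert_tensor hΛ₁ hΛ₂
  rwa [hz] at h

/-! ### The base certificate: degree 0 on three sites (the lineage's DARK law, separated design), by `decide`. -/

/-- the five-point degree-0 certificates on three sites, one per sign vector (found by Gaussian elimination). -/
def base3 : Bool → Bool → Bool → List (Fin 3 → Bool)
  | false, false, false => [![false, false, false], ![false, true, false], ![false, true, true], ![true, false, true],
      ![true, true, false]]
  | false, false, true => [![false, false, false], ![false, true, true], ![true, false, false], ![true, false, true],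
      ![true, true, false]]
  | false, true, false => [![false, false, false], ![false, true, true], ![true, false, true], ![true, true, false],
      ![true, true, true]]
  | false, true, true => [![false, false, true], ![false, true, false], ![true, false, false], ![true, true, false],
      ![true, true, true]]
  | true, false, false => [![false, false, true], ![false, true, false], ![true, false, false], ![true, true, false],
      ![true, true, true]]
  | true, false, true => [![false, false, false], ![false, true, true], ![true, false, true], ![true, true, false],
      ![true, true, true]]
  | true, true, false => [![false, false, false], ![false, true, true], ![true, false, false], ![true, false, true],
      ![true, true, false]]
  | true, true, true => [![false, false, false], ![false, true, false], ![false, true, true], ![true, false, true],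
      ![true, true, false]]

/-- the explicit three-site phase form (for `decide`). -/
def phase3 (z₀ z₁ z₂ : Bool) (ε : Fin 3 → Bool) (g : ℕ) : ZMod 3 :=
  ct (ε 0) (xor z₀ (decide (0 < g))) + ct (ε 1) (xor z₁ (decide (1 < g))) + ct (ε 2) (xor z₂ (decide (2 < g)))

/-- the phase on three sites, unfolded to the three sign bits (the form `decide` evaluates). -/
theorem phase_eq_phase3 (z ε : Fin 3 → Bool) (g : ℕ) : phase z ε g = phase3 (z 0) (z 1) (z 2) ε g := by
  unfold phase phase3
  rw [Fin.sum_univ_three]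
  rfl

/-- **BASE CORE** (`decide`, 8 sign vectors × 4 groups × 3 phases): the `base3` lists are degree-0 certificates. -/
theorem base3_core : ∀ z₀ z₁ z₂ : Bool, (base3 z₀ z₁ z₂).length % 2 = 1 ∧ ∀ g : Fin 4, ∀ c : ZMod 3,
    ((base3 z₀ z₁ z₂).countP fun ε => decide (c + phase3 z₀ z₁ z₂ ε g.val ≠ 2)) % 2 = 0 := by
  intro z₀ z₁ z₂
  cases z₀ <;> cases z₁ <;> cases z₂ <;> decide

/-- **`CertFamily 0 3`** — rung 0 of the ladder. -/
theorem certFamily_zero_three : CertFamily 0 3 := by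
  intro z
  refine ⟨base3 (z 0) (z 1) (z 2), (base3_core (z 0) (z 1) (z 2)).1, fun S hS g c => ?_⟩
  have hS0 : S = ∅ := Finset.card_eq_zero.mp (Nat.le_zero.mp hS)
  have hg : phase z = fun ε g => phase3 (z 0) (z 1) (z 2) ε g := funext fun ε => funext fun g => phase_eq_phase3 z ε g
  have htst : tst z S g c = fun ε => decide (c + phase3 (z 0) (z 1) (z 2) ε (min g 3) ≠ 2) := by
    funext ε
    unfold tst monoB
    rw [hS0]
    simp only [Finset.notMem_empty, IsEmpty.forall_iff, implies_true, decide_true, Bool.true_and]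
    by_cases h : 3 ≤ g
    · rw [min_eq_right h, ← phase_eq_phase3, phase_of_le z ε h]
    · rw [min_eq_left (by omega), hg]
  rw [htst]
  exact (base3_core (z 0) (z 1) (z 2)).2 ⟨min g 3, by omega⟩ c

/-- **rung 1 from the tree**: ResponseDial's 21-point certificates (`certOK_lam`, F = 5) are degree-1 certificates. -/
theorem certFamily_one_five : CertFamily 1 5 := by
  intro z
  obtain ⟨hodd, hc1, hc2⟩ := certOK_lam z
  refine ⟨(lam z).map εOf, ?_, fun S hS g c => ?_⟩
  · rw [List.length_map]; exact hodd
  have hph : ∀ ε : Fin 5 → Bool, ∀ g : ℕ, phase z ε g = sF z ε g := fun ε g => by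
    unfold phase sF; rw [Fin.sum_univ_five]; rfl
  have hg6 : ∀ ε : Fin 5 → Bool, phase z ε g = sF z ε (min g 5) := fun ε => by
    by_cases h : 5 ≤ g
    · rw [min_eq_right h, ← hph, phase_of_le z ε h]
    · rw [min_eq_left (by omega), hph]
  rw [List.countP_map]
  rcases Nat.lt_or_ge S.card 1 with h0 | h1
  · have hS0 : S = ∅ := Finset.card_eq_zero.mp (by omega)
    have : (tst z S g c ∘ εOf) = fun j => decide (c + sF z (εOf j) (min g 5) ≠ 2) := by
      funext j
      simp only [Function.comp, tst, monoB, hS0, Finset.notMem_empty, IsEmpty.forall_iff, implies_true,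
        decide_true, Bool.true_and, hg6]
    rw [this]
    exact hc1 ⟨min g 5, by omega⟩ c
  · obtain ⟨i, hi⟩ := Finset.card_eq_one.mp (le_antisymm hS h1)
    have : (tst z S g c ∘ εOf) = fun j => εOf j i && decide (c + sF z (εOf j) (min g 5) ≠ 2) := by
      funext j
      simp only [Function.comp, tst, monoB, hi, Finset.mem_singleton, forall_eq, hg6, Bool.decide_coe]
    rw [this]
    exact hc2 i ⟨min g 5, by omega⟩ c

/-- **ALL DEGREES**: `CertFamily d (3·(d+1))` — rung 0 tensored `d + 1` times. -/
theorem certFamily_all (d : ℕ) : CertFamily d (3 * (d + 1)) := by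
  induction d with
  | zero => exact certFamily_zero_three
  | succ d ih =>
    have h := certFamily_tensor ih certFamily_zero_three
    have e : 3 * (d + 1) + 3 = 3 * (d + 1 + 1) := by ring
    rw [e] at h
    simpa using h

/-- sharper mixed rungs from the tree's rung 1: e.g. degree 2 on 8 sites, degree 3 on 10 sites. -/
theorem certFamily_two_eight : CertFamily 2 8 := certFamily_tensor certFamily_one_five certFamily_zero_three

/-- an instance of the tensor rule: certificates of degree `3` on ten sites from two copies of `(1, 5)`. -/
theorem certFamily_three_ten : CertFamily 3 10 := certFamily_tensor certFamily_one_five certFamily_one_five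

end Cert

end Summit.QuantumAdvantage.QuantumAdvantage.Theorems.EchoDial
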